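import Literature.AlgebraicGeometry.AbelianSchemes.AbelianSchemeOverRestrictPt
import Literature.AlgebraicGeometry.AbelianSchemes.AbelianSchemeOverFibreIdentity
import Literature.AlgebraicGeometry.Motives.AbelianVarietyTorsionPointsCountProofs
import Literature.NumberTheory.DiophantineGeometry.AVGaloisModule
import HarnessLib

/-!
# A level-`N` structure on `ofAbelianVariety A₀` from a basis of the `N`-torsion `A₀[N](K)`
# ([MumfordFogartyKirwan1994] Ch. 7 §2 Def. 7.1; [MumfordAV1970] §6 App. 3; [GortzWedhorn2023] Prop. 27.188)

Topic `AlgebraicGeometry/AbelianSchemes`; namespace `Literature.AlgebraicGeometry.AbelianSchemes.AbelianSchemeOver`.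
Cell hodgecm-mathlib (D-0151), rung-0 U-DAG sub-row **U-a5 (σ)** (B-plan2 (g9) 2026-08-29T09:39:39Z: «the DATA
`φ_{Z,r} : LevelStructure g N (ofAbelianVariety A₀)` from the basis `m(r·eᵢ/N)` of `A₀[N](ℂ)` — ℂ-points as sections
over `Spec ℂ`, `pow_σ`, and the two basis clauses at EVERY geometric point `s : Spec Ω ⟶ Spec ℂ`, `Ω` algebraically
closed, `Ω ⊋ ℂ` allowed ⇒ needs «torsion does not grow»»; router B-plan1 (g10) R74/R75, B-plan2 (g9) R78).  CONSUMER: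
U-a — the algebraic realisation `P_{Z,r} : PolarizedAbelianSchemeWithLevel g N δ (Spec ℂ)` of a Siegel point `(Z, r)`;
this file supplies its `level` FIELD from the torsion basis `m(r·eᵢ/N)` of a marking `m`, and §5 gives the readings of
those sections at the identity fibre through ★ `fibreIdIso`, i.e. the `hlevel` hypothesis of ★ (b)
`SiegelAdelicMarking.exists_symplecticLift_of_levelReading` and the tower clause of ★ `IsAdmissibleAt`.  THEOREMS ONLY
(no definition, no named fact, no instance, no `sorry`); books 0.  HC_CM is proved only modulo the 7 printed citations
until rung 0 closes; this file discharges none of them.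

SETTING.  `A₀` an abelian variety over a field `K` (any characteristic; `K` need NOT be algebraically closed), `g` its
dimension, `N` invertible in `K`, and `2g` points `x : Fin g ⊕ Fin g → A₀(K)` of order dividing `N` which are
`ℤ/N`-INDEPENDENT: `a ↦ x^a := ∏ᵢ x(inl i)^{a(inl i)} · ∏ᵢ x(inr i)^{a(inr i)}` is injective on `(ℤ/N)^{2g}` (so they form a
basis of `A₀[N](K) ≅ (ℤ/N)^{2g}`, [MumfordAV1970] §6 App. 3).  The `K`-points of `A₀` ARE the sections of the abelian
scheme `ofAbelianVariety A₀ → Spec K` ([MumfordFogartyKirwan1994] Def. 7.1 «`2g` sections `σ₁, …, σ_{2g}` of `X` over `S`»):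
`A₀(K) = (Spec K →_K A₀)` and `X(S) = (𝟙_{Over S} ⟶ X)` are the same hom-set of `Over (Spec K)` up to the identification
`Spec (algebraMap K K) = 𝟙`.

* §1 POINTS AS SECTIONS: every `K`-point `P` is (the underlying morphism of) a unique section `σ` (`(σ).left = P.left`),
  compatibly with the group laws (`exists_section_left_eq`, `section_eq_of_left_eq`, `mul`/`pow`/`sectionPow` transfer);
* §2 READING AT A GEOMETRIC POINT `s = Spec (K → Ω)`: the restriction `σ(s)` of the section of `P` IS the extension of
  scalars `P_Ω ∈ A₀(Ω)` (★ `AlgPoints.extendScalars`, injective) — `restrict_eq_extendScalars_of_left_eq`; every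
  `s : Spec Ω ⟶ Spec K` is of this form (Mathlib `Spec.map_surjective`);
* §3 TORSION DOES NOT GROW ([MumfordAV1970] §6 App. 3 / [GortzWedhorn2023] Prop. 27.188 (1), the tree's UNCONDITIONAL
  ★ `AbelianVariety.natCard_torsionPoints_eq_of_isAlgClosed`): for `Ω ⊇ K` algebraically closed, an injective
  `(ℤ/N)^{2g} → A₀[N](Ω)` is bijective (`#A₀[N](Ω) = N^{2g}`) — `bijective_torsion_of_injective`;
* §4 **`LevelStructure.exists_of_torsionBasis`** — THE HEAD: there is a (unique) level-`N` structure `φ` on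
  `ofAbelianVariety A₀` ([MumfordFogartyKirwan1994] Def. 7.1: `pow_σ`, `basis_injective`, `basis_surjective` at EVERY
  geometric point) whose sections are the given points: `(φ.σ i).left = (x i).left`;
* §5 READING AT THE IDENTITY FIBRE for the (U3)-consumers (★ (b) `SiegelAdelicMarking.exists_symplecticLift_of_levelReading`'s
  `hlevel`, ★ `IsAdmissibleAt`): `restrictPt (𝟙 _) σ` is carried to `P` by the identity-fibre isomorphism
  ★ `fibreIdIso` (`map_fibreIdIso_restrictPt_of_left_eq`).

## References
* [MumfordFogartyKirwan1994] D. Mumford, J. Fogarty, F. Kirwan, *Geometric Invariant Theory*, 3rd ed. (1994), Ch. 7 §2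
  Definition 7.1 (p. 129).
* [MumfordAV1970] D. Mumford, *Abelian Varieties* (1970), §6 Application 3 (Proposition p. 64).
* [GortzWedhorn2023] U. Görtz, T. Wedhorn, *Algebraic Geometry II* (2023), Prop. 27.188 (1) (p. 888).
* [Hartshorne1977] R. Hartshorne, *Algebraic Geometry*, II Ex. 2.7 (points with values in a field).
-/

set_option autoImplicit false

universe u

open CategoryTheory CategoryTheory.Limits AlgebraicGeometry MonoidalCategory

noncomputable section

namespace Literature.AlgebraicGeometry.AbelianSchemes

namespace AbelianSchemeOver

open Literature.AlgebraicGeometry.Motives (SchemeOver AbelianVariety AlgPoints specOver)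
open Literature.AlgebraicGeometry.Motives.AlgPoints (extendScalars extendScalars_injective specOverMap)
open scoped MonObj

variable {K : Type u} [Field K] (A₀ : AbelianVariety K)

/-! ### §1. `K`-points of `A₀` as sections of `ofAbelianVariety A₀ → Spec K` -/

/-- The structure morphism of `specOver K K` is the identity of `Spec K` (`Spec (algebraMap K K) = 𝟙`).
[cite: Hartshorne1977, II Ex. 2.7] -/
theorem specOver_self_hom : (specOver K K).hom = 𝟙 (Spec (.of K)) := by
  change Spec.map (CommRingCat.ofHom (algebraMap K K)) = _
  rw [Algebra.algebraMap_self, CommRingCat.ofHom_id, Spec.map_id]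

/-- A `K`-point `P : Spec K →_K A₀` has `P ≫ (A₀ → Spec K) = 𝟙`, i.e. it is a section of the structure morphism.
[cite: MumfordFogartyKirwan1994, Ch. 7 §2 Definition 7.1 (p. 129)] -/
theorem point_left_comp_hom (P : A₀.Points K) : P.left ≫ A₀.X.hom = 𝟙 (Spec (.of K)) := by
  rw [Over.w P]
  exact specOver_self_hom

/-- **POINTS ARE SECTIONS**: every `K`-point `P` of `A₀` is the underlying morphism of a section of
`ofAbelianVariety A₀ → Spec K`. [cite: MumfordFogartyKirwan1994, Ch. 7 §2 Definition 7.1 (p. 129)] -/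
theorem exists_section_left_eq (P : A₀.Points K) :
    ∃ σ : (ofAbelianVariety A₀).Sections, @Eq (Spec (.of K) ⟶ A₀.X.left) σ.left P.left :=
  ⟨Over.homMk (P.left : Spec (.of K) ⟶ A₀.X.left)
      (show (P.left : Spec (.of K) ⟶ A₀.X.left) ≫ A₀.X.hom = (𝟙_ (Over (Spec (.of K)))).hom by
        rw [Over.tensorUnit_hom]; exact point_left_comp_hom A₀ P), rfl⟩

/-- … and conversely every section is the underlying morphism of a `K`-point.
[cite: MumfordFogartyKirwan1994, Ch. 7 §2 Definition 7.1 (p. 129)] -/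
theorem exists_point_left_eq (σ : (ofAbelianVariety A₀).Sections) :
    ∃ P : A₀.Points K, @Eq (Spec (.of K) ⟶ A₀.X.left) P.left σ.left :=
  ⟨Over.homMk (σ.left : Spec (.of K) ⟶ A₀.X.left)
      (show (σ.left : Spec (.of K) ⟶ A₀.X.left) ≫ A₀.X.hom = Spec.map (CommRingCat.ofHom (algebraMap K K)) by
        rw [Algebra.algebraMap_self, CommRingCat.ofHom_id, Spec.map_id, ← Over.tensorUnit_hom (X := Spec (.of K))]
        exact Over.w σ), rfl⟩

/-- Sections are determined by their underlying morphisms. [cite: MumfordFogartyKirwan1994, Ch. 7 §2 Definition 7.1 (p. 129)] -/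
theorem section_eq_of_left_eq {σ τ : (ofAbelianVariety A₀).Sections} (h : σ.left = τ.left) : σ = τ :=
  Over.OverMorphism.ext h

/-- `K`-points (and `L`-points) are determined by their underlying morphisms. [cite: Hartshorne1977, II Ex. 2.7] -/
theorem point_eq_of_left_eq {L : Type u} [Field L] [Algebra K L] {P Q : A₀.Points L} (h : P.left = Q.left) :
    P = Q :=
  Over.OverMorphism.ext h

/-- **POINTS → SECTIONS IS A GROUP HOMOMORPHISM**: there is a monoid homomorphism `A₀(K) →* X(Spec K)` (pre-composition
with the canonical `K`-isomorphism `𝟙_ ⟶ specOver K K`, multiplicative by Mathlib `MonObj.comp_mul`) sending each point to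
the section with the same underlying morphism. [cite: MumfordFogartyKirwan1994, Ch. 7 §2 Definition 7.1 (p. 129)] -/
theorem exists_pointsToSections_monoidHom :
    ∃ I : A₀.Points K →* (ofAbelianVariety A₀).Sections, ∀ P, @Eq (Spec (.of K) ⟶ A₀.X.left) (I P).left P.left := by
  let uK : 𝟙_ (Over (Spec (.of K))) ⟶ specOver K K :=
    Over.homMk (𝟙 (Spec (.of K))) (by
      show 𝟙 (Spec (.of K)) ≫ Spec.map (CommRingCat.ofHom (algebraMap K K)) = 𝟙 (Spec (.of K))
      rw [Category.id_comp, Algebra.algebraMap_self, CommRingCat.ofHom_id, Spec.map_id])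
  refine ⟨{ toFun := fun P => uK ≫ (P : specOver K K ⟶ A₀.X)
            map_one' := MonObj.comp_one uK
            map_mul' := fun P Q => MonObj.comp_mul uK P Q }, fun P => ?_⟩
  show 𝟙 (Spec (.of K)) ≫ P.left = P.left
  exact Category.id_comp _

/-- The section of `P` is the value of any such homomorphism at `P`. [cite: MumfordFogartyKirwan1994, Ch. 7 §2 Definition 7.1 (p. 129)] -/
theorem eq_map_of_left_eq (I : A₀.Points K →* (ofAbelianVariety A₀).Sections)
    (hI : ∀ P, @Eq (Spec (.of K) ⟶ A₀.X.left) (I P).left P.left)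
    {σ : (ofAbelianVariety A₀).Sections} {P : A₀.Points K} (h : @Eq (Spec (.of K) ⟶ A₀.X.left) σ.left P.left) :
    σ = I P :=
  section_eq_of_left_eq A₀ (h.trans (hI P).symm)

/-- **The group laws agree**: if `σ, τ` are the sections of `P, Q`, then `σ · τ` is the section of `P · Q`.
[cite: MumfordFogartyKirwan1994, Ch. 7 §2 Definition 7.1 (p. 129)] -/
theorem mul_left_eq_of_left_eq {σ τ : (ofAbelianVariety A₀).Sections} {P Q : A₀.Points K}
    (hσ : @Eq (Spec (.of K) ⟶ A₀.X.left) σ.left P.left) (hτ : @Eq (Spec (.of K) ⟶ A₀.X.left) τ.left Q.left) :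
    @Eq (Spec (.of K) ⟶ A₀.X.left) (σ * τ).left (P * Q).left := by
  obtain ⟨I, hI⟩ := exists_pointsToSections_monoidHom A₀
  rw [eq_map_of_left_eq A₀ I hI hσ, eq_map_of_left_eq A₀ I hI hτ, ← map_mul, hI]

/-- The identity section is the section of the identity point. [cite: MumfordFogartyKirwan1994, Ch. 7 §2 Definition 7.1 (p. 129)] -/
theorem one_left_eq : @Eq (Spec (.of K) ⟶ A₀.X.left) (1 : (ofAbelianVariety A₀).Sections).left (1 : A₀.Points K).left := by
  obtain ⟨I, hI⟩ := exists_pointsToSections_monoidHom A₀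
  rw [← hI 1, map_one]

/-- Powers agree: if `σ` is the section of `P`, then `σ ^ n` is the section of `P ^ n`.
[cite: MumfordFogartyKirwan1994, Ch. 7 §2 Definition 7.1 (p. 129)] -/
theorem pow_left_eq_of_left_eq {σ : (ofAbelianVariety A₀).Sections} {P : A₀.Points K}
    (hσ : @Eq (Spec (.of K) ⟶ A₀.X.left) σ.left P.left) (n : ℕ) :
    @Eq (Spec (.of K) ⟶ A₀.X.left) (σ ^ n).left (P ^ n).left := by
  obtain ⟨I, hI⟩ := exists_pointsToSections_monoidHom A₀
  rw [eq_map_of_left_eq A₀ I hI hσ, ← map_pow, hI]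

/-- A section is `n`-torsion iff its point is: `σ ^ n = 1 ↔ P ^ n = 1` — print's clause (ii) `ψ_n ∘ σᵢ = ε` read on
points. [cite: MumfordFogartyKirwan1994, Ch. 7 §2 Definition 7.1 (p. 129)] -/
theorem pow_eq_one_iff_of_left_eq {σ : (ofAbelianVariety A₀).Sections} {P : A₀.Points K}
    (hσ : @Eq (Spec (.of K) ⟶ A₀.X.left) σ.left P.left) (n : ℕ) :
    σ ^ n = 1 ↔ P ^ n = 1 := by
  constructor
  · intro h
    apply point_eq_of_left_eq A₀
    rw [← pow_left_eq_of_left_eq A₀ hσ n, h, one_left_eq A₀]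
  · intro h
    apply section_eq_of_left_eq A₀
    rw [pow_left_eq_of_left_eq A₀ hσ n, h, one_left_eq A₀]

/-- Mumford's `σ^a = ∏ᵢ σ(inl i)^{a(inl i)} · ∏ᵢ σ(inr i)^{a(inr i)}` is the section of the same ordered product of the
points. [cite: MumfordFogartyKirwan1994, Ch. 7 §2 Definition 7.1 (p. 129)] -/
theorem sectionPow_left_eq_of_left_eq {g n : ℕ} {σ : Fin g ⊕ Fin g → (ofAbelianVariety A₀).Sections}
    {x : Fin g ⊕ Fin g → A₀.Points K} (hσ : ∀ i, @Eq (Spec (.of K) ⟶ A₀.X.left) (σ i).left (x i).left)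
    (a : Fin g ⊕ Fin g → ZMod n) :
    @Eq (Spec (.of K) ⟶ A₀.X.left) ((ofAbelianVariety A₀).sectionPow σ a).left
      ((List.ofFn fun i : Fin g => x (Sum.inl i) ^ (a (Sum.inl i)).val).prod *
        (List.ofFn fun i : Fin g => x (Sum.inr i) ^ (a (Sum.inr i)).val).prod).left := by
  obtain ⟨I, hI⟩ := exists_pointsToSections_monoidHom A₀
  have hIx : ∀ i, σ i = I (x i) := fun i => eq_map_of_left_eq A₀ I hI (hσ i)
  have h : (ofAbelianVariety A₀).sectionPow σ a =
      I ((List.ofFn fun i : Fin g => x (Sum.inl i) ^ (a (Sum.inl i)).val).prod *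
        (List.ofFn fun i : Fin g => x (Sum.inr i) ^ (a (Sum.inr i)).val).prod) := by
    rw [sectionPow, map_mul, map_list_prod, map_list_prod, List.map_ofFn, List.map_ofFn]
    simp only [Function.comp_def, map_pow, hIx]
  rw [h, hI]

/-! ### §2. Reading a section at the geometric point `Spec (K → Ω)`: extension of scalars of the point -/

section Reading

variable (Ω : Type u) [Field Ω] [Algebra K Ω]

/-- **`σ(s) = P_Ω` at `s = Spec (K → Ω)`** (underlying morphisms): the restriction of the section of `P` to the fibre
over the geometric point `Spec Ω → Spec K` (D1 `restrict`) has the underlying morphism of the extension of scalars of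
`P` (★ `AlgPoints.extendScalars`): both are `Spec (K → Ω) ≫ P`. [cite: MumfordFogartyKirwan1994, Ch. 7 §2 Definition 7.1 (p. 129)] [cite: Hartshorne1977, II Ex. 2.7] -/
theorem restrict_left_eq_extendScalars_left_of_left_eq {σ : (ofAbelianVariety A₀).Sections} {P : A₀.Points K}
    (hσ : @Eq (Spec (.of K) ⟶ A₀.X.left) σ.left P.left) :
    ((ofAbelianVariety A₀).restrict (Spec.map (CommRingCat.ofHom (algebraMap K Ω))) σ).left =
      (extendScalars A₀.X K Ω P).left := by
  rw [restrict_left, hσ, AlgPoints.extendScalars_apply, Over.comp_left, AlgPoints.specOverMap_left]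
  rfl

/-- **`σ(s) = P_Ω`**: in the D1 currency `FibrePoints s = (Over.mk s ⟶ X)`, which at `s = Spec (K → Ω)` IS the type
`A₀(Ω) = AlgPoints A₀.X Ω` of `Ω`-points over `K`, the restriction of the section of `P` is the extension of scalars
`P_Ω`. [cite: MumfordFogartyKirwan1994, Ch. 7 §2 Definition 7.1 (p. 129)] [cite: Hartshorne1977, II Ex. 2.7] -/
theorem restrict_eq_extendScalars_of_left_eq {σ : (ofAbelianVariety A₀).Sections} {P : A₀.Points K}
    (hσ : @Eq (Spec (.of K) ⟶ A₀.X.left) σ.left P.left) :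
    ((ofAbelianVariety A₀).restrict (Spec.map (CommRingCat.ofHom (algebraMap K Ω))) σ :
        AlgPoints A₀.X Ω) = extendScalars A₀.X K Ω P :=
  point_eq_of_left_eq A₀ (restrict_left_eq_extendScalars_left_of_left_eq A₀ Ω hσ)

/-- The same for Mumford's `σ^a`: `(σ^a)(s) = (x^a)_Ω` (underlying morphisms). [cite: MumfordFogartyKirwan1994, Ch. 7 §2 Definition 7.1 (p. 129)] -/
theorem restrict_sectionPow_left_eq {g n : ℕ} {σ : Fin g ⊕ Fin g → (ofAbelianVariety A₀).Sections}
    {x : Fin g ⊕ Fin g → A₀.Points K} (hσ : ∀ i, @Eq (Spec (.of K) ⟶ A₀.X.left) (σ i).left (x i).left)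
    (a : Fin g ⊕ Fin g → ZMod n) :
    ((ofAbelianVariety A₀).restrict (Spec.map (CommRingCat.ofHom (algebraMap K Ω)))
        ((ofAbelianVariety A₀).sectionPow σ a)).left =
      (extendScalars A₀.X K Ω
        ((List.ofFn fun i : Fin g => x (Sum.inl i) ^ (a (Sum.inl i)).val).prod *
          (List.ofFn fun i : Fin g => x (Sum.inr i) ^ (a (Sum.inr i)).val).prod)).left :=
  restrict_left_eq_extendScalars_left_of_left_eq A₀ Ω (sectionPow_left_eq_of_left_eq A₀ hσ a)

/-- The same for Mumford's `σ^a`: `(σ^a)(s) = (x^a)_Ω` in `A₀(Ω)`. [cite: MumfordFogartyKirwan1994, Ch. 7 §2 Definition 7.1 (p. 129)] -/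
theorem restrict_sectionPow_eq_extendScalars {g n : ℕ} {σ : Fin g ⊕ Fin g → (ofAbelianVariety A₀).Sections}
    {x : Fin g ⊕ Fin g → A₀.Points K} (hσ : ∀ i, @Eq (Spec (.of K) ⟶ A₀.X.left) (σ i).left (x i).left)
    (a : Fin g ⊕ Fin g → ZMod n) :
    ((ofAbelianVariety A₀).restrict (Spec.map (CommRingCat.ofHom (algebraMap K Ω)))
        ((ofAbelianVariety A₀).sectionPow σ a) : AlgPoints A₀.X Ω) =
      extendScalars A₀.X K Ω
        ((List.ofFn fun i : Fin g => x (Sum.inl i) ^ (a (Sum.inl i)).val).prod *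
          (List.ofFn fun i : Fin g => x (Sum.inr i) ^ (a (Sum.inr i)).val).prod) :=
  point_eq_of_left_eq A₀ (restrict_sectionPow_left_eq A₀ Ω hσ a)

end Reading

/-! ### §3. Torsion does not grow: an independent `2g`-tuple of `N`-torsion points is a basis over every `Ω = Ω̄` -/

/-- The ordered product `x^a` lies in `A₀[N](L)` when every `xᵢ` does (in the commutative group `A₀(L)`).
[cite: MumfordAV1970, §6 Application 3 (Proposition p. 64)] -/
theorem pointPow_pow_eq_one {L : Type u} [Field L] [Algebra K L] {g N : ℕ} {x : Fin g ⊕ Fin g → A₀.Points L}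
    (hx : ∀ i, x i ^ N = 1) (a : Fin g ⊕ Fin g → ZMod N) :
    ((List.ofFn fun i : Fin g => x (Sum.inl i) ^ (a (Sum.inl i)).val).prod *
        (List.ofFn fun i : Fin g => x (Sum.inr i) ^ (a (Sum.inr i)).val).prod) ^ N = 1 := by
  have h : ∀ (i) (m : ℕ), (x i ^ m) ^ N = 1 := fun i m => by rw [← pow_mul, mul_comm, pow_mul, hx, one_pow]
  rw [List.prod_ofFn, List.prod_ofFn, mul_pow, ← Finset.prod_pow, ← Finset.prod_pow]
  simp [h]

/-- **TORSION DOES NOT GROW** ([MumfordAV1970] §6 App. 3 «`X_n(k) ≅ (ℤ/n)^{2g}` for `k = k̄`, `p ∤ n`»;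
[GortzWedhorn2023] Prop. 27.188 (1)): over an algebraically closed `Ω ⊇ K`, for `N` invertible in `K` and `g = dim A₀`,
an INJECTIVE map `(ℤ/N)^{2g} → A₀(Ω)` with values in `A₀[N](Ω)` hits every `N`-torsion point — `#A₀[N](Ω) = N^{2g}` by the
tree's unconditional count ★ `AbelianVariety.natCard_torsionPoints_eq_of_isAlgClosed`.
[cite: MumfordAV1970, §6 Application 3 (Proposition p. 64)] [cite: GortzWedhorn2023, Prop. 27.188 (1) (p. 888)] -/
theorem exists_eq_of_injective_of_pow_eq_one {Ω : Type u} [Field Ω] [Algebra K Ω] [IsAlgClosed Ω] {g N : ℕ}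
    (hg : A₀.dim = g) (hN : (N : K) ≠ 0) (f : (Fin g ⊕ Fin g → ZMod N) → A₀.Points Ω)
    (hf : Function.Injective f) (hfN : ∀ a, f a ^ N = 1) (y : A₀.Points Ω) (hy : y ^ N = 1) :
    ∃ a, f a = y := by
  have hN₀ : N ≠ 0 := by rintro rfl; exact hN (by simp)
  haveI : NeZero N := ⟨hN₀⟩
  have hmem : ∀ {z : A₀.Points Ω}, z ^ N = 1 → z ∈ A₀.torsionPoints Ω (N : ℤ) := fun hz => by
    rw [AbelianVariety.mem_torsionPoints_iff, zpow_natCast, hz]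
  -- the restricted map `(ℤ/N)^{2g} → A₀[N](Ω)`
  let F : (Fin g ⊕ Fin g → ZMod N) → A₀.torsionPoints Ω (N : ℤ) := fun a => ⟨f a, hmem (hfN a)⟩
  have hF : Function.Injective F := fun a b h => hf (congrArg Subtype.val h)
  have hcardT : Nat.card (A₀.torsionPoints Ω (N : ℤ)) = N ^ (2 * g) := by
    have h := A₀.natCard_torsionPoints_eq_of_isAlgClosed Ω (N : ℤ) (by exact_mod_cast hN)
    rw [hg] at h
    simpa using h
  haveI : Finite (A₀.torsionPoints Ω (N : ℤ)) := by
    apply Nat.finite_of_card_ne_zero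
    rw [hcardT]
    exact pow_ne_zero _ hN₀
  have hcard : Nat.card (A₀.torsionPoints Ω (N : ℤ)) ≤ Nat.card (Fin g ⊕ Fin g → ZMod N) := by
    rw [hcardT, Nat.card_eq_fintype_card, Fintype.card_fun, ZMod.card, Fintype.card_sum, Fintype.card_fin, two_mul]
  obtain ⟨a, ha⟩ := (hF.bijective_of_nat_card_le hcard).2 ⟨y, hmem hy⟩
  exact ⟨a, congrArg Subtype.val ha⟩

/-! ### §4. The level structure -/

/-- **A basis of `A₀[N](K)` is a level-`N` structure on `ofAbelianVariety A₀ → Spec K`** ([MumfordFogartyKirwan1994] Ch. 7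
§2 Def. 7.1): for an abelian variety `A₀` of dimension `g` over a field `K`, `N` invertible in `K`, and `2g` points
`xᵢ ∈ A₀(K)` of order dividing `N` such that `a ↦ x^a = ∏ᵢ x(inl i)^{a(inl i)} · ∏ᵢ x(inr i)^{a(inr i)}` is injective on
`(ℤ/N)^{2g}`, there is a level-`N` structure `φ` on the abelian scheme `ofAbelianVariety A₀` whose basis sections ARE the
`xᵢ` (`(φ.σ i).left = (x i).left`; unique by `section_eq_of_left_eq`).  Clause (ii) `pow_σ` is `xᵢ^N = 1` read on sections
(§1); clause (i) at a geometric point `s : Spec Ω → Spec K` (`Ω` algebraically closed, possibly bigger than `K`;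
`s = Spec (K → Ω)` by Mathlib `Spec.map_surjective`): `(σ^a)(s) = (x^a)_Ω` (§2), extension of scalars is injective
(★ `AlgPoints.extendScalars_injective`), and torsion does not grow (§3).  No hypothesis `IsAlgClosed K`.
[cite: MumfordFogartyKirwan1994, Ch. 7 §2 Definition 7.1 (p. 129)] [cite: MumfordAV1970, §6 Application 3 (Proposition p. 64)] -/
theorem LevelStructure.exists_of_torsionBasis {g N : ℕ} (hg : A₀.dim = g) (hN : (N : K) ≠ 0)
    (x : Fin g ⊕ Fin g → A₀.Points K) (hx : ∀ i, x i ^ N = 1)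
    (hinj : Function.Injective fun a : Fin g ⊕ Fin g → ZMod N =>
      (List.ofFn fun i : Fin g => x (Sum.inl i) ^ (a (Sum.inl i)).val).prod *
        (List.ofFn fun i : Fin g => x (Sum.inr i) ^ (a (Sum.inr i)).val).prod) :
    ∃ φ : LevelStructure g N (ofAbelianVariety A₀), ∀ i, @Eq (Spec (.of K) ⟶ A₀.X.left) (φ.σ i).left (x i).left := by
  -- the sections
  have hσ : ∀ i, ∃ σ : (ofAbelianVariety A₀).Sections, @Eq (Spec (.of K) ⟶ A₀.X.left) σ.left (x i).left :=
    fun i => exists_section_left_eq A₀ (x i)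
  choose σ hσ using hσ
  refine ⟨⟨σ, fun i => (pow_eq_one_iff_of_left_eq A₀ (hσ i) N).2 (hx i), ?_, ?_⟩, hσ⟩
  · -- (i), injectivity at the geometric point `s = Spec f`
    intro Ω _ _ s
    obtain ⟨f, rfl⟩ := Spec.map_surjective s
    letI : Algebra K Ω := f.hom.toAlgebra
    change Function.Injective fun a : Fin g ⊕ Fin g → ZMod N =>
      (ofAbelianVariety A₀).restrict (Spec.map (CommRingCat.ofHom (algebraMap K Ω))) ((ofAbelianVariety A₀).sectionPow σ a)
    intro a b hab
    have hab' := congrArg (fun t => t.left) hab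
    dsimp only at hab'
    rw [restrict_sectionPow_left_eq A₀ Ω hσ a, restrict_sectionPow_left_eq A₀ Ω hσ b] at hab'
    exact hinj (extendScalars_injective A₀.X K Ω (Over.OverMorphism.ext hab'))
  · -- (i), surjectivity onto the `N`-torsion at the geometric point `s = Spec f`
    intro Ω _ _ s
    obtain ⟨f, rfl⟩ := Spec.map_surjective s
    letI : Algebra K Ω := f.hom.toAlgebra
    change ∀ y : AlgPoints A₀.X Ω, y ^ N = 1 → ∃ a : Fin g ⊕ Fin g → ZMod N,
      ((ofAbelianVariety A₀).restrict (Spec.map (CommRingCat.ofHom (algebraMap K Ω)))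
        ((ofAbelianVariety A₀).sectionPow σ a) : AlgPoints A₀.X Ω) = y
    intro y hy
    have hfN : ∀ a : Fin g ⊕ Fin g → ZMod N, extendScalars A₀.X K Ω
        ((List.ofFn fun i : Fin g => x (Sum.inl i) ^ (a (Sum.inl i)).val).prod *
          (List.ofFn fun i : Fin g => x (Sum.inr i) ^ (a (Sum.inr i)).val).prod) ^ N = 1 := fun a => by
      rw [← AlgPoints.extendScalarsMonoidHom_apply, ← map_pow, pointPow_pow_eq_one A₀ hx a, map_one]
    obtain ⟨a, ha⟩ := exists_eq_of_injective_of_pow_eq_one A₀ hg hN _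
      ((extendScalars_injective A₀.X K Ω).comp hinj) hfN y hy
    exact ⟨a, (restrict_sectionPow_eq_extendScalars A₀ Ω hσ a).trans ha⟩


/-! ### §5. Reading at the identity fibre (the `hlevel` currency of the (U3) consumers) -/

section IdentityFibre

variable {K₁ : Type} [Field K₁] (A₁ : AbelianVariety K₁)

/-- **`σ(𝟙) = P` through the identity-fibre isomorphism**: the `K`-point `σ(𝟙)` of the identity fibre
`(ofAbelianVariety A₁) ×_{Spec K} Spec K` (D1 `restrictPt` at `s = 𝟙`, the currency of ★ D3 `SymplecticLift.lift_level`,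
★ (b) `SiegelAdelicMarking.exists_symplecticLift_of_levelReading`'s `hlevel` and ★ `IsAdmissibleAt`) is carried by the
identity-fibre isomorphism ★ `fibreIdIso` ([GortzWedhorn2020] (4.7) `X ×_S S = X`) to the point `P` of `A₁` whose section
`σ` is — so a marking of `A₁` transported along `fibreIdIso` reads the sections of §4 at the given points.
[cite: MumfordFogartyKirwan1994, Ch. 7 §2 Definition 7.1 (p. 129) and Definition 7.3 (p. 129)] -/
theorem map_fibreIdIso_restrictPt_id_of_left_eq {σ : (ofAbelianVariety A₁).Sections} {P : A₁.Points K₁}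
    (hσ : @Eq (Spec (.of K₁) ⟶ A₁.X.left) σ.left P.left) :
    AlgPoints.map (fibreIdIso (ofAbelianVariety A₁)).hom.hom.hom.hom
        ((ofAbelianVariety A₁).restrictPt (𝟙 (Spec (.of K₁))) σ) = P := by
  apply point_eq_of_left_eq A₁
  rw [AlgPoints.map_apply, Over.comp_left, fibreIdIso_hom_hom, fibreIdToGrpIso_hom_left]
  -- `σ(𝟙) ≫ (A ×_S S → A) = 𝟙 ≫ σ = σ`
  exact ((ofAbelianVariety A₁).restrictPt_left_fst (𝟙 (Spec (.of K₁))) σ).trans ((Category.id_comp _).trans hσ)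

/-- The same for a whole family: the identity-fibre isomorphism carries `σᵢ(𝟙)` to `xᵢ` for every `i` — the hypothesis
shape `hσ` of ★ `section_comp_grpIso_eq` / `levelStructure_isBaseChangeVia_id_of_fibreIso`.
[cite: MumfordFogartyKirwan1994, Ch. 7 §2 Definition 7.3 (p. 129)] -/
theorem map_fibreIdIso_restrictPt_id_eq_of_forall_left_eq {ι' : Type*} {σ : ι' → (ofAbelianVariety A₁).Sections}
    {x : ι' → A₁.Points K₁} (hσ : ∀ i, @Eq (Spec (.of K₁) ⟶ A₁.X.left) (σ i).left (x i).left) (i : ι') :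
    AlgPoints.map (fibreIdIso (ofAbelianVariety A₁)).hom.hom.hom.hom
        ((ofAbelianVariety A₁).restrictPt (𝟙 (Spec (.of K₁))) (σ i)) = x i :=
  map_fibreIdIso_restrictPt_id_of_left_eq A₁ (hσ i)

end IdentityFibre

end AbelianSchemeOver

end Literature.AlgebraicGeometry.AbelianSchemes

end
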